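import Summits.AtomisticToContinuum.Crystallization.Theorems.ExcessDecayLiouvilleLatticeSums
import Summits.AtomisticToContinuum.Crystallization.Theorems.ExcessDecayLiouvilleTwoLatticeForce

/-!
# Route `ExcessDecayLiouville`: cutoffs on the site set and the nearest-neighbour strain of translates

Two elementary ingredients of step (c2) of the energy route for item `ExcessDecay`
(stmt-AtomisticToContinuum-9334; evidence `ExcessDecay-proof-architecture-v2.md`, §5):

* `tsum_norm_sub_map_sq_le_nnForm` : for any injective self-map `σ` of the sites with `dist p (σ p) ≤ 11/10`
  (a nearest-neighbour lattice translation inside a sublattice — `tsum_norm_sub_translate_sq_le_nnForm` — or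
  the inter-layer nearest-neighbour maps between the sublattices) and a finitely supported displacement
  `v`, `Σ'_p ‖v p − v (σ p)‖² ≤ nnForm t A v` — the nearest-neighbour strain form dominates the squared
  finite differences, so a Caccioppoli bound on `nnForm` IS a bound on the discrete gradient;
* the radial site cutoff `η(x) = [x ∈ S] · max (min 1 ((r₁ + ρ − dist x c)/ρ)) 0`: values in `[0,1]`
  (`siteCutoff_nonneg`, `siteCutoff_le_one`), `= 1` on the sites of the ball `dist · c ≤ r₁`
  (`siteCutoff_eq_one`), `= 0` off the sites and off the ball `dist · c < r₁ + ρ` (`siteCutoff_eq_zero*`),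
  finitely supported inside the site set (`siteCutoff_support_finite`, `siteCutoff_support_subset`), and of
  slope `1/ρ` between sites (`abs_siteCutoff_sub_le`) — exactly the hypotheses of `caccioppoli_l2`.
  The cutoff is written out as an explicit expression in every statement (no new definition).

All `[folklore]`; helper lemmas, nothing here closes an item.
-/

noncomputable section

namespace Summit.AtomisticToContinuum.Crystallization.Theorems.ExcessDecayLiouville

open scoped BigOperators Topology InnerProductSpace RealInnerProductSpace Classical
open Literature.MathematicalPhysics.StatisticalMechanics
open Summit.AtomisticToContinuum.Crystallization.Theorems.PhononStabilityNegative

section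

variable {t : Fin 2 → EuclideanSpace ℝ (Fin 3)} {A : EuclideanSpace ℝ (Fin 3) →L[ℝ] EuclideanSpace ℝ (Fin 3)}

/-! ## The strain form dominates squared translation differences -/

/-- The squared differences along an injective self-map of the sites form a finitely supported (hence
summable) family, for finitely supported `v`. [folklore] -/
theorem summable_norm_sub_map_sq {v : EuclideanSpace ℝ (Fin 3) → EuclideanSpace ℝ (Fin 3)}
    (hv : (Function.support v).Finite) {σ : Sites₀ t A → Sites₀ t A} (hσ : Function.Injective σ) :
    Summable (fun p : Sites₀ t A => ‖v p - v (σ p)‖ ^ 2) := by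
  classical
  set T := (finite_support_sites (t := t) (A := A) hv).toFinset with hT
  have hpre : Set.Finite {p : Sites₀ t A | σ p ∈ (T : Set (Sites₀ t A))} :=
    (T.finite_toSet.preimage hσ.injOn)
  refine summable_of_ne_finset_zero (s := T ∪ hpre.toFinset) ?_
  intro p hp
  rw [Finset.notMem_union] at hp
  have hvp : v p = 0 := by
    by_contra h
    exact hp.1 ((Set.Finite.mem_toFinset _).2 h)
  have hvq : v (σ p) = 0 := by
    by_contra h
    apply hp.2
    refine (Set.Finite.mem_toFinset _).2 ?_
    simp only [Set.mem_setOf_eq, Finset.mem_coe]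
    exact (Set.Finite.mem_toFinset _).2 h
  simp [hvp, hvq]

/-- **`nnForm` dominates the squared differences along any short injective self-map of the sites**: if
`dist p (σ p) ≤ 11/10` for all sites `p` (e.g. a nearest-neighbour lattice translation inside a sublattice,
or the inter-layer nearest-neighbour maps between the two sublattices), then for finitely supported `v`,
`Σ'_p ‖v p − v (σ p)‖² ≤ nnForm t A v`. [folklore] -/
theorem tsum_norm_sub_map_sq_le_nnForm (hA : Adm₀ A) (hI : Inner₀ t A)
    {v : EuclideanSpace ℝ (Fin 3) → EuclideanSpace ℝ (Fin 3)} (hv : (Function.support v).Finite)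
    {σ : Sites₀ t A → Sites₀ t A} (hσ : Function.Injective σ)
    (hdist : ∀ p : Sites₀ t A, dist (p : EuclideanSpace ℝ (Fin 3)) (σ p) ≤ 11 / 10) :
    ∑' p : Sites₀ t A, ‖v p - v (σ p)‖ ^ 2 ≤ nnForm t A v := by
  classical
  unfold nnForm
  have hle : ∀ p : Sites₀ t A, ‖v p - v (σ p)‖ ^ 2 ≤
      ∑' q : Sites₀ t A, (if dist (p : EuclideanSpace ℝ (Fin 3)) q ≤ 11 / 10 then ‖v p - v q‖ ^ 2 else 0) := by
    intro p
    have h := (summable_nnRow hA hI v p).le_tsum (σ p) (fun q _ => by positivity)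
    rw [if_pos (hdist p)] at h
    exact h
  exact (summable_norm_sub_map_sq hv hσ).tsum_le_tsum hle (summable_nnRows hA hI hv)

/-- Translation by a lattice vector as an injective self-map of the sites with the expected values. [folklore] -/
theorem sitesTranslate_injective {τ : EuclideanSpace ℝ (Fin 3)} (hτ : τ ∈ Λ₀) :
    Function.Injective (fun p : Sites₀ t A =>
      (⟨(p : EuclideanSpace ℝ (Fin 3)) + A τ, add_mem_sites₀ p.2 hτ⟩ : Sites₀ t A)) := by
  intro p q h
  have : (p : EuclideanSpace ℝ (Fin 3)) + A τ = (q : EuclideanSpace ℝ (Fin 3)) + A τ := congrArg Subtype.val h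
  exact Subtype.ext (add_right_cancel this)

/-- **`nnForm` dominates the squared finite differences along a short lattice translation**: for `τ ∈ Λ₀`
with `‖Aτ‖ ≤ 11/10` and finitely supported `v`, `Σ'_p ‖v p − v (p + Aτ)‖² ≤ nnForm t A v`. [folklore] -/
theorem tsum_norm_sub_translate_sq_le_nnForm (hA : Adm₀ A) (hI : Inner₀ t A)
    {v : EuclideanSpace ℝ (Fin 3) → EuclideanSpace ℝ (Fin 3)} (hv : (Function.support v).Finite)
    {τ : EuclideanSpace ℝ (Fin 3)} (hτ : τ ∈ Λ₀) (hτn : ‖A τ‖ ≤ 11 / 10) :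
    ∑' p : Sites₀ t A, ‖v p - v ((p : EuclideanSpace ℝ (Fin 3)) + A τ)‖ ^ 2 ≤ nnForm t A v := by
  have h := tsum_norm_sub_map_sq_le_nnForm hA hI hv (sitesTranslate_injective (t := t) (A := A) hτ) (fun p => by
    show dist (p : EuclideanSpace ℝ (Fin 3)) ((p : EuclideanSpace ℝ (Fin 3)) + A τ) ≤ 11 / 10
    rw [dist_eq_norm, sub_add_cancel_left, norm_neg]
    exact hτn)
  exact h

/-! ## The radial site cutoff -/

/-- `0 ≤ η`. [folklore] -/
theorem siteCutoff_nonneg (c : EuclideanSpace ℝ (Fin 3)) (r₁ ρ : ℝ) (x : EuclideanSpace ℝ (Fin 3)) :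
    0 ≤ (if x ∈ Sites₀ t A then max (min 1 ((r₁ + ρ - dist x c) / ρ)) 0 else 0) := by
  split_ifs
  · exact le_max_right _ _
  · exact le_rfl

/-- `η ≤ 1`. [folklore] -/
theorem siteCutoff_le_one (c : EuclideanSpace ℝ (Fin 3)) (r₁ ρ : ℝ) (x : EuclideanSpace ℝ (Fin 3)) :
    (if x ∈ Sites₀ t A then max (min 1 ((r₁ + ρ - dist x c) / ρ)) 0 else 0) ≤ 1 := by
  split_ifs
  · exact max_le (min_le_left _ _) zero_le_one
  · exact zero_le_one

/-- `η = 1` on the sites of the inner ball. [folklore] -/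
theorem siteCutoff_eq_one {c : EuclideanSpace ℝ (Fin 3)} {r₁ ρ : ℝ} (hρ : 0 < ρ) {x : EuclideanSpace ℝ (Fin 3)}
    (hx : x ∈ Sites₀ t A) (hxc : dist x c ≤ r₁) :
    (if x ∈ Sites₀ t A then max (min 1 ((r₁ + ρ - dist x c) / ρ)) 0 else 0) = 1 := by
  rw [if_pos hx]
  have h1 : 1 ≤ (r₁ + ρ - dist x c) / ρ := by
    rw [le_div_iff₀ hρ]; linarith
  rw [min_eq_left h1, max_eq_left zero_le_one]

/-- `η = 0` off the sites. [folklore] -/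
theorem siteCutoff_eq_zero_of_not_mem {c : EuclideanSpace ℝ (Fin 3)} {r₁ ρ : ℝ} {x : EuclideanSpace ℝ (Fin 3)}
    (hx : x ∉ Sites₀ t A) :
    (if x ∈ Sites₀ t A then max (min 1 ((r₁ + ρ - dist x c) / ρ)) 0 else 0) = 0 := by
  rw [if_neg hx]

/-- `η = 0` off the outer ball. [folklore] -/
theorem siteCutoff_eq_zero_of_le {c : EuclideanSpace ℝ (Fin 3)} {r₁ ρ : ℝ} (hρ : 0 < ρ) {x : EuclideanSpace ℝ (Fin 3)}
    (hxc : r₁ + ρ ≤ dist x c) :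
    (if x ∈ Sites₀ t A then max (min 1 ((r₁ + ρ - dist x c) / ρ)) 0 else 0) = 0 := by
  split_ifs
  · have h1 : (r₁ + ρ - dist x c) / ρ ≤ 0 := div_nonpos_of_nonpos_of_nonneg (by linarith) hρ.le
    rw [max_eq_right ((min_le_right _ _).trans h1)]
  · rfl

/-- The support of `η` lies in the site set. [folklore] -/
theorem siteCutoff_support_subset (c : EuclideanSpace ℝ (Fin 3)) (r₁ ρ : ℝ) :
    (Function.support fun x : EuclideanSpace ℝ (Fin 3) =>
      (if x ∈ Sites₀ t A then max (min 1 ((r₁ + ρ - dist x c) / ρ)) 0 else 0)) ⊆ Sites₀ t A := by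
  intro x hx
  by_contra h
  exact hx (siteCutoff_eq_zero_of_not_mem h)

/-- The support of `η` is finite (sites of the outer ball). [folklore] -/
theorem siteCutoff_support_finite (hA : Adm₀ A) (hI : Inner₀ t A) (c : EuclideanSpace ℝ (Fin 3)) (r₁ : ℝ) {ρ : ℝ}
    (hρ : 0 < ρ) :
    (Function.support fun x : EuclideanSpace ℝ (Fin 3) =>
      (if x ∈ Sites₀ t A then max (min 1 ((r₁ + ρ - dist x c) / ρ)) 0 else 0)).Finite := by
  refine (finite_sites_dist_le hA hI c (r₁ + ρ)).subset fun x hx => ?_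
  refine ⟨siteCutoff_support_subset c r₁ ρ hx, ?_⟩
  by_contra h
  exact hx (siteCutoff_eq_zero_of_le hρ (le_of_not_ge h))

/-- **Slope `1/ρ` between sites**: `|η p − η q| ≤ ‖p − q‖/ρ` for sites `p, q`. [folklore] -/
theorem abs_siteCutoff_sub_le {c : EuclideanSpace ℝ (Fin 3)} {r₁ ρ : ℝ} (hρ : 0 < ρ) (p q : Sites₀ t A) :
    |(if (p : EuclideanSpace ℝ (Fin 3)) ∈ Sites₀ t A then
          max (min 1 ((r₁ + ρ - dist (p : EuclideanSpace ℝ (Fin 3)) c) / ρ)) 0 else 0) -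
        (if (q : EuclideanSpace ℝ (Fin 3)) ∈ Sites₀ t A then
          max (min 1 ((r₁ + ρ - dist (q : EuclideanSpace ℝ (Fin 3)) c) / ρ)) 0 else 0)| ≤
      ‖(p : EuclideanSpace ℝ (Fin 3)) - q‖ / ρ := by
  rw [if_pos p.2, if_pos q.2]
  refine (abs_max_sub_max_le_abs _ _ _).trans ?_
  refine (abs_min_sub_min_le_max _ _ _ _).trans ?_
  rw [sub_self, abs_zero]
  refine max_le (by positivity) ?_
  rw [← sub_div, abs_div, abs_of_pos hρ]
  refine div_le_div_of_nonneg_right ?_ hρ.le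
  rw [← dist_eq_norm]
  have := abs_dist_sub_le (q : EuclideanSpace ℝ (Fin 3)) (p : EuclideanSpace ℝ (Fin 3)) c
  have heq : r₁ + ρ - dist (p : EuclideanSpace ℝ (Fin 3)) c - (r₁ + ρ - dist (q : EuclideanSpace ℝ (Fin 3)) c) =
      dist (q : EuclideanSpace ℝ (Fin 3)) c - dist (p : EuclideanSpace ℝ (Fin 3)) c := by ring
  rw [heq, dist_comm (p : EuclideanSpace ℝ (Fin 3)) q]
  exact this

end

end Summit.AtomisticToContinuum.Crystallization.Theorems.ExcessDecayLiouville

end
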